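import Mathlib
import Literature.Analysis.Complex.SimilarityPrincipleC1
import Literature.Analysis.Complex.CauchyTransformBoundedModulus
import Literature.Analysis.FunctionSpaces.EquicontinuousExtraction
import HarnessLib

/-!
# The similarity principle for `C¹` functions: continuous factor and leading term

Continuation of `Literature/Analysis/Complex/SimilarityPrincipleC1.lean`. For a `C¹` function
`c : ℂ → ℂ` with `‖∂̄ c‖ ≤ M ‖c‖` on `‖z‖ ≤ ρ` we prove the similarity principle in its genuine
FACTORISED form and the expansion at a zero (I. N. Vekua, *Generalized analytic functions* (1962),
Ch. III §4; L. Bers (1953); C. Wendl, *Lectures on Contact 3-Manifolds, Holomorphic Curves and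
Intersection Theory* (2020), App. B, Thm. B.20 and Cor. B.21):

* `similarity_factorisation_C1` — on every smaller disc `‖z‖ < ρ'` one has `c = e^{s} H` with `s`
  CONTINUOUS and bounded and `H` holomorphic (Thm. B.20: `c = Φ f`, `Φ` continuous invertible,
  `f` holomorphic — here for the trivial line bundle, `Φ = e^{s}`);
* `similarity_leadingTerm_C1` — if `c 0 = 0` and `c` does not vanish identically on the open disc,
  there are `m ≥ 1` and `C ≠ 0` with `c z / z^m → C` as `z → 0`, i.e.
  `c(z) = C z^m + o(|z|^m)` (Cor. B.21);
* `contDiffOn_one_of_punctured_bounds`, `similarity_dichotomy_punctured` — the form consumed at a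
  critical point: `f` is `C¹` only on a PUNCTURED disc, with `f 0 = 0`, `‖f‖ ≤ C |z|^{k+1}`,
  `‖Df‖ ≤ C |z|^k` (`k ≥ 1`, so that the extension by zero is `C¹`) and `‖∂̄ f‖ ≤ M ‖f‖` there;
  then either `f ≡ 0` near `0`, or `f z / z^m → A ≠ 0` for some `m ≥ k + 1`, and `f ≠ 0` on a
  punctured neighbourhood; `similarity_dichotomy_punctured_of_fderiv_bounded` needs only `Df`
  BOUNDED near the puncture (and any `k ≥ 0`), by passing to `z f(z)`, and
  `similarity_dichotomy_punctured'` assumes nothing about `f 0`;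
  `similarity_dichotomy_punctured_landau` restates the second alternative as
  `f(z) = A z^m + o(|z|^m)` (`isLittleO_sub_mul_pow_of_tendsto_div_pow`), and
  `wind_circleLoop_eq_of_tendsto_div_pow` identifies `m` with the winding number of `f` on small
  circles (the local intersection index); `tendsto_div_pow_of_norm_sub_le` (transfer of the
  leading term through a relative perturbation) and `exists_norm_sub_mul_pow_le_half` (the
  `½`-scale unpacking `‖f z - A z^m‖ ≤ ‖A‖ ‖z‖^m / 2`) are the forms used downstream.

This is the form in which the principle enters the representation formula for branch differences
of `J`-holomorphic curves at critical points (Wendl 2020, Thm. B.23 / (B.12): `η = z^ℓ C + o(|z|^ℓ)`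
for the `C¹` normal component `η` of the difference of two branches).

Proof. The approximation scheme of `similarity_comparison_C1` produces smooth potentials
`s_n = T a_n` of densities `a_n` which are bounded by `M + 1` UNIFORMLY in `n` and supported in the
disc `‖z‖ < ρ`; by the Hölder-`1/2` modulus of the Cauchy transform on bounded densities
(`Literature.Analysis.Complex.norm_cauchyTransform_sub_le_sqrt`) the `s_n` are equicontinuous and
uniformly bounded, so (Arzelà–Ascoli,
`Literature.Analysis.FunctionSpaces.exists_strictMono_tendstoLocallyUniformlyOn_of_equicontinuous`)
a subsequence converges locally uniformly to a continuous `s`, along which the holomorphic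
approximants `H_n` (`‖e^{-s_n} c - H_n‖ → 0`) converge by Montel to a holomorphic `H`; hence
`e^{-s} c = H`. At a zero, `H = z^m G` with `G(0) ≠ 0` (isolated zeros of the non-trivial
holomorphic `H`), so `c z / z^m = e^{s z} G z → e^{s 0} G 0 ≠ 0`.

Everything is proved; no named facts.

## References

* I. N. Vekua, *Generalized analytic functions* (1962), Ch. III, §4 (similarity principle).
* C. Wendl, *Lectures on Contact 3-Manifolds, Holomorphic Curves and Intersection Theory* (2020),
  App. B, Thm B.20, Cor B.21, Thm B.23. [Wendl2020]
* D. McDuff, D. Salamon, *J-holomorphic curves and symplectic topology*, 2nd ed. (2012), §2.3.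
  [McDuffSalamon2012]
-/

noncomputable section

open scoped ContDiff ComplexConjugate Topology
open Filter Set Metric Complex
open Literature.Topology.PlaneTopology

namespace Literature.Analysis.Complex

namespace Similarity

/-! ### Potentials with a uniform modulus of continuity -/

/-- **The potential, with its modulus.** For a smooth compactly supported density `a` with
`‖a‖ ≤ M` vanishing where `ρ₀ ≤ ‖z‖`, the Cauchy transform `s = T a` is smooth, solves `∂̄ s = a`,
satisfies `‖s‖ ≤ 2 (ρ + ρ₀) M` on `‖z‖ ≤ ρ`, and has the Hölder modulus
`‖s z - s z'‖ ≤ 2 M (3 + 2 (ρ₀ + ρ)) √‖z - z'‖` for `‖z‖ ≤ ρ`, `‖z - z'‖ ≤ 1/4` — a modulus depending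
on `a` only through `M` and `ρ₀`. [folklore] -/
theorem exists_potential_holder {a : ℂ → ℂ} {ρ₀ ρ M : ℝ} (hρ₀ : 0 ≤ ρ₀) (hρ : 0 ≤ ρ) (hM : 0 ≤ M)
    (ha : ContDiff ℝ ∞ a) (hac : HasCompactSupport a) (haM : ∀ z, ‖a z‖ ≤ M)
    (ha0 : ∀ z : ℂ, ρ₀ ≤ ‖z‖ → a z = 0) :
    ∃ s : ℂ → ℂ, ContDiff ℝ ∞ s ∧ (∀ z, dbarAlong 1 s z = a z) ∧
      (∀ z : ℂ, ‖z‖ ≤ ρ → ‖s z‖ ≤ 2 * (ρ + ρ₀) * M) ∧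
      ∀ z z' : ℂ, ‖z‖ ≤ ρ → ‖z - z'‖ ≤ 1 / 4 →
        ‖s z - s z'‖ ≤ 2 * M * (3 + 2 * (ρ₀ + ρ)) * Real.sqrt ‖z - z'‖ := by
  have hsupp : ∀ z : ℂ, a z ≠ 0 → ‖z‖ < ρ₀ := fun z hz => lt_of_not_ge fun h => hz (ha0 z h)
  refine ⟨cauchyTransformAlong 1 a, contDiff_cauchyTransformAlong ha hac one_ne_zero,
    dbarAlong_cauchyTransformAlong (ha.of_le (by exact_mod_cast le_top)) hac one_ne_zero,
    fun _ hz => norm_cauchyTransform_le_of_bound hρ₀ hρ hM ha0 haM hz, fun z z' hz hzz' => ?_⟩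
  have h := norm_cauchyTransform_sub_le_sqrt ha.continuous.aestronglyMeasurable hM hρ₀ haM hsupp
    hzz'
  refine h.trans (mul_le_mul_of_nonneg_right ?_ (Real.sqrt_nonneg _))
  have : 3 + 2 * (ρ₀ + ‖z‖) ≤ 3 + 2 * (ρ₀ + ρ) := by linarith
  nlinarith

/-- **The approximation package with defect and modulus.** As `Similarity.exists_approx_defect`,
recording in addition the uniform Hölder modulus of the potential `s` (which depends only on
`M` and `ρ`). [folklore] -/
theorem exists_approx_defect_holder {w r χ : ℂ → ℂ} {M ε ρ ρ' ρ'' C S : ℝ} (hM : 0 ≤ M)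
    (hε : 0 ≤ ε) (hρ : 0 ≤ ρ) (hρ'' : ρ'' ≤ ρ) (hS : 2 * (ρ + ρ) * (M + 1) ≤ S)
    (hw : ContDiff ℝ ∞ w) (hr : ContDiff ℝ ∞ r) (hdbar : ∀ η, dbarAlong 1 w η = r η)
    (hbound : ∀ η : ℂ, ‖η‖ ≤ ρ → ‖r η‖ ≤ M * ‖w η‖ + ε)
    (hχ : ContDiff ℝ ∞ χ) (hχ1 : ∀ z : ℂ, ‖z‖ ≤ ρ'' → χ z = 1)
    (hχ0 : ∀ z : ℂ, χ z ≠ 0 → ‖z‖ < ρ) (hχle : ∀ z : ℂ, ‖χ z‖ ≤ 1)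
    (hC : ∀ (k : ℂ → ℂ) (ε : ℝ), ContDiff ℝ ∞ k → 0 ≤ ε →
      (∀ η : ℂ, ‖η‖ ≤ ρ'' → ‖dbarAlong 1 k η‖ ≤ ε) →
      ∃ H : ℂ → ℂ, DifferentiableOn ℂ H (ball 0 ρ') ∧ ∀ η : ℂ, ‖η‖ ≤ ρ' → ‖k η - H η‖ ≤ C * ε)
    {t : ℝ} (ht : 0 < t) (hεt : ε ≤ t) :
    ∃ s H : ℂ → ℂ, ContDiff ℝ ∞ s ∧ (∀ z : ℂ, ‖z‖ ≤ ρ → ‖s z‖ ≤ S) ∧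
      (∀ z z' : ℂ, ‖z‖ ≤ ρ → ‖z - z'‖ ≤ 1 / 4 →
        ‖s z - s z'‖ ≤ 2 * (M + 1) * (3 + 2 * (ρ + ρ)) * Real.sqrt ‖z - z'‖) ∧
      DifferentiableOn ℂ H (ball 0 ρ') ∧
      ∀ z : ℂ, ‖z‖ ≤ ρ' →
        ‖Complex.exp (-s z) * w z - H z‖ ≤ C * (Real.exp S * ((M / 2 + 1) * t)) := by
  -- the localised coefficient `r̃ = χ r`
  set r' : ℂ → ℂ := fun η => χ η * r η with hr'_def
  have hr' : ContDiff ℝ ∞ r' := hχ.mul hr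
  have hsupp : ∀ η : ℂ, ρ ≤ ‖η‖ → r' η = 0 := fun η hη => by
    have hχη : χ η = 0 := by
      by_contra h
      exact (not_lt.2 hη) (hχ0 η h)
    simp [hr'_def, hχη]
  have hbound' : ∀ η, ‖r' η‖ ≤ M * ‖w η‖ + ε := fun η => by
    by_cases hη : ‖η‖ ≤ ρ
    · calc ‖r' η‖ = ‖χ η‖ * ‖r η‖ := norm_mul _ _
        _ ≤ 1 * (M * ‖w η‖ + ε) :=
            mul_le_mul (hχle η) (hbound η hη) (norm_nonneg _) zero_le_one
        _ = M * ‖w η‖ + ε := one_mul _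
    · rw [hsupp η (not_le.1 hη).le, norm_zero]
      positivity
  -- the regularised coefficient with `δ = t²`
  set a : ℂ → ℂ := fun η => r' η * conj (w η) / (((‖w η‖ ^ 2 + t ^ 2 : ℝ)) : ℂ)
    with ha_def
  have hδ : 0 < t ^ 2 := by positivity
  have ha : ContDiff ℝ ∞ a := contDiff_coeff w r' (t ^ 2) hδ hw hr'
  have hac : HasCompactSupport a := hasCompactSupport_coeff w r' ρ (t ^ 2) hsupp
  have hsq : Real.sqrt (t ^ 2) = t := Real.sqrt_sq ht.le
  have haM : ∀ η, ‖a η‖ ≤ M + 1 := fun η => by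
    have h := norm_coeff_le_of_defect w r' M ε (t ^ 2) hM hε hδ hbound' η
    rw [hsq] at h
    have h2 : ε * (2 * t)⁻¹ ≤ 1 := by
      rw [mul_inv_le_iff₀ (by positivity)]
      linarith
    exact h.trans (by linarith)
  have ha0 : ∀ η : ℂ, ρ ≤ ‖η‖ → a η = 0 := fun η hη => by simp [ha_def, hsupp η hη]
  have har : ∀ η, ‖r' η - a η * w η‖ ≤ (M / 2 + 1) * t := fun η => by
    have h := norm_sub_coeff_mul_le_of_defect w r' M ε (t ^ 2) hM hε hδ hbound' η
    rw [hsq] at h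
    calc ‖r' η - a η * w η‖ ≤ M * t / 2 + ε := h
      _ ≤ (M / 2 + 1) * t := by nlinarith
  -- the potential, with modulus
  obtain ⟨s, hs, hds, hsS, hmod⟩ :=
    exists_potential_holder (ρ := ρ) hρ hρ (by positivity : (0 : ℝ) ≤ M + 1) ha hac haM ha0
  have hsS' : ∀ z : ℂ, ‖z‖ ≤ ρ → ‖s z‖ ≤ S := fun z hz => (hsS z hz).trans hS
  have hsd : Differentiable ℝ s := hs.differentiable (by simp)
  have hwd : Differentiable ℝ w := hw.differentiable (by simp)
  -- the modified function `h = e^{-s} w`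
  set h : ℂ → ℂ := fun z => Complex.exp (-s z) * w z with hh_def
  have hh : ContDiff ℝ ∞ h := hs.neg.cexp.mul hw
  have hdh : ∀ z : ℂ, ‖z‖ ≤ ρ'' → ‖dbarAlong 1 h z‖ ≤ Real.exp S * ((M / 2 + 1) * t) := by
    intro z hz
    have hrz : r z = r' z := by simp [hr'_def, hχ1 z hz]
    rw [hh_def, dbarAlong_one_exp_neg_mul (hsd z) (hwd z), hdbar z, hds z, norm_mul, hrz]
    exact mul_le_mul (norm_exp_neg_le (hsS' z (by linarith))) (har z) (norm_nonneg _)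
      (Real.exp_pos S).le
  obtain ⟨H, hH, hHh⟩ := hC h (Real.exp S * ((M / 2 + 1) * t)) hh (by positivity) hdh
  exact ⟨s, H, hs, hsS', hmod, hH, hHh⟩

end Similarity

open Similarity

/-! ### The factorisation `c = e^{s} H` with continuous `s` -/

/-- **Similarity principle for `C¹` functions, factorised form** (Bers–Vekua; Wendl 2020,
Thm B.20). Let `c : ℂ → ℂ` be `C¹` with `‖∂̄ c‖ ≤ M ‖c‖` on `‖z‖ ≤ ρ`, and `0 < ρ' < ρ`. Then on the
disc `‖z‖ < ρ'` one has `c = e^{s} H` with `s` continuous and bounded (`‖s‖ ≤ S`) and `H`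
holomorphic. [cite: Wendl2020, App. B Thm B.20 (similarity principle)] -/
theorem similarity_factorisation_C1 (c : ℂ → ℂ) (M ρ ρ' : ℝ) (hρ' : 0 < ρ') (hρ : ρ' < ρ)
    (hc : ContDiff ℝ 1 c)
    (hbound : ∀ η : ℂ, ‖η‖ ≤ ρ → ‖dbarAlong 1 c η‖ ≤ M * ‖c η‖) :
    ∃ (S : ℝ) (s H : ℂ → ℂ), ContinuousOn s (ball 0 ρ') ∧ DifferentiableOn ℂ H (ball 0 ρ') ∧
      (∀ z ∈ ball (0 : ℂ) ρ', ‖s z‖ ≤ S) ∧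
      ∀ z ∈ ball (0 : ℂ) ρ', c z = Complex.exp (s z) * H z := by
  -- the degenerate case `c ≡ 0` on `‖z‖ ≤ ρ`
  by_cases hne : ∃ z : ℂ, ‖z‖ ≤ ρ ∧ c z ≠ 0
  swap
  · push Not at hne
    refine ⟨0, 0, 0, continuousOn_const, differentiableOn_const 0, fun z _ => by simp,
      fun z hz => ?_⟩
    rw [hne z (by linarith [mem_ball_zero_iff.1 hz])]
    simp
  obtain ⟨z₁, hz₁, h1⟩ := hne
  have hM : 0 ≤ M :=
    nonneg_of_mul_nonneg_left ((norm_nonneg _).trans (hbound z₁ hz₁)) (norm_pos_iff.2 h1)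
  have hρ0 : 0 ≤ ρ := by linarith
  -- compactly supported modification `c₀ = χ₀ c`, equal to `c` on `‖z‖ ≤ ρ + 1`
  obtain ⟨χ₀, hχ₀, hχ₀c, hχ₀1, -, -⟩ :=
    Similarity.exists_cutoff (ρm := ρ + 1) (ρ := ρ + 2) (by linarith) (by linarith)
  set c₀ : ℂ → ℂ := fun z => χ₀ z * c z with hc₀_def
  have hc₀ : ContDiff ℝ 1 c₀ := (hχ₀.of_le (by exact_mod_cast le_top)).mul hc
  have hc₀s : HasCompactSupport c₀ := hχ₀c.mul_right
  have hc₀eq : ∀ z : ℂ, ‖z‖ ≤ ρ + 1 → c₀ z = c z := fun z hz => by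
    simp [hc₀_def, hχ₀1 z hz]
  have hdbar₀ : ∀ z : ℂ, ‖z‖ ≤ ρ → dbarAlong 1 c₀ z = dbarAlong 1 c z := by
    intro z hz
    refine dbarAlong_congr_of_eventuallyEq ?_ 1
    filter_upwards [Metric.ball_mem_nhds z one_pos] with y hy
    refine hc₀eq y ?_
    have h1 : ‖y - z‖ < 1 := by rwa [mem_ball, dist_eq_norm] at hy
    have h2 := norm_le_insert' y z
    linarith
  -- the approximation scheme, keeping the modulus of the potentials
  obtain ⟨C, hC0, hC⟩ := exists_holomorphic_approx_of_dbar_le ρ' ((ρ' + ρ) / 2) hρ' (by linarith)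
  obtain ⟨χ, hχ, -, hχ1, hχ0, hχle⟩ :=
    Similarity.exists_cutoff (ρm := (ρ' + ρ) / 2) (ρ := ρ) (by linarith) (by linarith)
  set S : ℝ := 2 * (ρ + ρ) * (M + 1) with hS_def
  set L : ℝ := 2 * (M + 1) * (3 + 2 * (ρ + ρ)) with hL_def
  have hL0 : 0 ≤ L := by positivity
  set A : ℝ := C * (Real.exp S * (M / 2 + 1)) + Real.exp S / (M + 1) with hA_def
  have hA0 : 0 ≤ A := by positivity
  have key : ∀ n : ℕ, ∃ s H : ℂ → ℂ, ContDiff ℝ ∞ s ∧ (∀ z : ℂ, ‖z‖ ≤ ρ → ‖s z‖ ≤ S) ∧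
      (∀ z z' : ℂ, ‖z‖ ≤ ρ → ‖z - z'‖ ≤ 1 / 4 → ‖s z - s z'‖ ≤ L * Real.sqrt ‖z - z'‖) ∧
      DifferentiableOn ℂ H (ball 0 ρ') ∧
      ∀ z : ℂ, ‖z‖ ≤ ρ' →
        ‖Complex.exp (-s z) * c z - H z‖ ≤ A * (1 / ((n : ℝ) + 1)) := by
    intro n
    set t : ℝ := 1 / ((n : ℝ) + 1) with ht_def
    have ht : 0 < t := by positivity
    set η : ℝ := t / (M + 1) with hη_def
    have hη : 0 < η := by positivity
    have hηt : (M + 1) * η = t := by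
      rw [hη_def]; field_simp
    obtain ⟨w, hw, hw0, hw1, hwI⟩ := exists_smooth_approx_C1 hc₀ hc₀s hη
    have hr : ContDiff ℝ ∞ (dbarAlong 1 w) := by
      have hD : ContDiff ℝ ∞ (fderiv ℝ w) := (contDiff_infty_iff_fderiv.1 hw).2
      have h : dbarAlong 1 w = fun z => (2 : ℂ)⁻¹ • (fderiv ℝ w z 1 + I • fderiv ℝ w z I) :=
        funext fun z => dbarAlong_one w z
      rw [h]
      have h1 : ContDiff ℝ ∞ fun z => fderiv ℝ w z 1 := hD.clm_apply contDiff_const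
      have h2 : ContDiff ℝ ∞ fun z => fderiv ℝ w z I := hD.clm_apply contDiff_const
      have h3 : ContDiff ℝ ∞ fun z => I • fderiv ℝ w z I := (contDiff_const (c := I)).smul h2
      exact (contDiff_const (c := (2 : ℂ)⁻¹)).smul (h1.add h3)
    have hbd : ∀ z : ℂ, ‖z‖ ≤ ρ → ‖dbarAlong 1 w z‖ ≤ M * ‖w z‖ + t := by
      intro z hz
      have e2 : ‖dbarAlong 1 c₀ z‖ ≤ M * ‖c₀ z‖ := by
        rw [hdbar₀ z hz, hc₀eq z (by linarith)]
        exact hbound z hz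
      have h := smooth_dbar_defect hM (hw0 z) (hw1 z) (hwI z) e2
      rwa [hηt] at h
    obtain ⟨s, H, hs, hsS, hmod, hH, happ⟩ :=
      exists_approx_defect_holder (ρ'' := (ρ' + ρ) / 2) hM ht.le hρ0 (by linarith) le_rfl hw hr
        (fun _ => rfl) hbd hχ hχ1 hχ0 hχle hC ht le_rfl
    refine ⟨s, H, hs, hsS, hmod, hH, fun z hz => ?_⟩
    have h1 := happ z hz
    have h2 : ‖Complex.exp (-s z) * c z - Complex.exp (-s z) * w z‖ ≤ Real.exp S * η := by
      rw [← mul_sub, norm_mul, ← hc₀eq z (by linarith), norm_sub_rev]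
      exact mul_le_mul (norm_exp_neg_le (hsS z (by linarith))) (hw0 z) (norm_nonneg _)
        (Real.exp_pos S).le
    calc ‖Complex.exp (-s z) * c z - H z‖
        ≤ ‖Complex.exp (-s z) * c z - Complex.exp (-s z) * w z‖ +
            ‖Complex.exp (-s z) * w z - H z‖ := norm_sub_le_norm_sub_add_norm_sub _ _ _
      _ ≤ Real.exp S * η + C * (Real.exp S * ((M / 2 + 1) * t)) := add_le_add h2 h1
      _ = A * t := by rw [hA_def, hη_def]; ring
  choose s Hn hs hsS hmod hH happ using key
  -- uniform bound for the `Hn` on the disc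
  obtain ⟨W, hW⟩ := (isCompact_closedBall (0 : ℂ) ρ').exists_bound_of_continuousOn
    hc.continuous.continuousOn
  have hB : ∀ n, ∀ z ∈ ball (0 : ℂ) ρ', ‖Hn n z‖ ≤ Real.exp S * W + A := by
    intro n z hz
    have hz' : ‖z‖ ≤ ρ' := (mem_ball_zero_iff.1 hz).le
    have h1 := happ n z hz'
    have h2 : ‖Complex.exp (-s n z) * c z‖ ≤ Real.exp S * W := by
      rw [norm_mul]
      exact mul_le_mul (norm_exp_neg_le (hsS n z (by linarith)))
        (hW z (mem_closedBall_zero_iff.2 hz')) (norm_nonneg _) (Real.exp_pos S).le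
    have h3 : A * (1 / ((n : ℝ) + 1)) ≤ A := by
      have : 1 / ((n : ℝ) + 1) ≤ 1 := by
        rw [div_le_one (by positivity)]
        linarith [n.cast_nonneg (α := ℝ)]
      nlinarith
    have h4 := norm_le_insert (Complex.exp (-s n z) * c z) (Hn n z)
    linarith
  -- Montel: `Hn ∘ φ₁ → Hlim` locally uniformly on the disc
  obtain ⟨Hlim, φ₁, hφ₁, hHlim, hloc, -⟩ :=
    Complex.exists_strictMono_tendstoLocallyUniformlyOn_of_norm_le isOpen_ball hH hB
  -- Arzelà–Ascoli: `s ∘ φ₁ ∘ φ₂ → g` locally uniformly on the disc, `g` continuous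
  have heq : Equicontinuous fun n => (ball (0 : ℂ) ρ').restrict (s (φ₁ n)) := by
    intro x₀
    rw [Metric.equicontinuousAt_iff]
    intro ε hε
    refine ⟨min (1 / 4) ((ε / (L + 1)) ^ 2), lt_min (by norm_num) (by positivity), ?_⟩
    intro x hx n
    have hx4 : ‖(x₀ : ℂ) - x‖ ≤ 1 / 4 := by
      rw [← dist_eq_norm, dist_comm]; exact (lt_of_lt_of_le hx (min_le_left _ _)).le
    have hxε : ‖(x₀ : ℂ) - x‖ < (ε / (L + 1)) ^ 2 := by
      rw [← dist_eq_norm, dist_comm]; exact lt_of_lt_of_le hx (min_le_right _ _)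
    have hx₀ρ : ‖(x₀ : ℂ)‖ ≤ ρ := by
      have := mem_ball_zero_iff.1 x₀.2
      linarith
    change dist (s (φ₁ n) x₀) (s (φ₁ n) x) < ε
    rw [dist_eq_norm]
    have hsqrt : Real.sqrt ‖(x₀ : ℂ) - x‖ < ε / (L + 1) := by
      calc Real.sqrt ‖(x₀ : ℂ) - x‖ < Real.sqrt ((ε / (L + 1)) ^ 2) :=
            Real.sqrt_lt_sqrt (norm_nonneg _) hxε
        _ = ε / (L + 1) := Real.sqrt_sq (by positivity)
    calc ‖s (φ₁ n) x₀ - s (φ₁ n) x‖ ≤ L * Real.sqrt ‖(x₀ : ℂ) - x‖ := hmod (φ₁ n) x₀ x hx₀ρ hx4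
      _ ≤ (L + 1) * Real.sqrt ‖(x₀ : ℂ) - x‖ := by gcongr; linarith
      _ < (L + 1) * (ε / (L + 1)) := by gcongr
      _ = ε := by field_simp
  have hbs : ∀ x ∈ ball (0 : ℂ) ρ', ∃ (y₀ : ℂ) (B : ℝ), ∀ n, dist (s (φ₁ n) x) y₀ ≤ B :=
    fun x hx => ⟨0, S, fun n => by
      rw [dist_zero_right]
      exact hsS (φ₁ n) x (by linarith [mem_ball_zero_iff.1 hx])⟩
  obtain ⟨g, φ₂, hφ₂, hg, hgloc⟩ :=
    Literature.Analysis.FunctionSpaces.exists_strictMono_tendstoLocallyUniformlyOn_of_equicontinuous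
      (G := fun n => s (φ₁ n)) isOpen_ball heq hbs
  -- identification `e^{-g} c = Hlim` on the disc
  have herr : Tendsto (fun k => A * (1 / ((φ₁ (φ₂ k) : ℝ) + 1))) atTop (𝓝 0) := by
    have h1 : Tendsto (fun k => 1 / ((φ₁ (φ₂ k) : ℝ) + 1)) atTop (𝓝 0) :=
      (tendsto_one_div_add_atTop_nhds_zero_nat (𝕜 := ℝ)).comp
        (hφ₁.comp hφ₂).tendsto_atTop
    have h2 := h1.const_mul A
    rwa [mul_zero] at h2
  have hident : ∀ z ∈ ball (0 : ℂ) ρ', Complex.exp (-g z) * c z = Hlim z := by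
    intro z hz
    have hz' : ‖z‖ ≤ ρ' := (mem_ball_zero_iff.1 hz).le
    -- the two convergences at `z`
    have hH : Tendsto (fun k => Hn (φ₁ (φ₂ k)) z) atTop (𝓝 (Hlim z)) :=
      (hloc.tendsto_at hz).comp hφ₂.tendsto_atTop
    have hsz : Tendsto (fun k => s (φ₁ (φ₂ k)) z) atTop (𝓝 (g z)) := hgloc.tendsto_at hz
    have hez : Tendsto (fun k => Complex.exp (-s (φ₁ (φ₂ k)) z) * c z) atTop
        (𝓝 (Complex.exp (-g z) * c z)) :=
      ((Complex.continuous_exp.tendsto _).comp hsz.neg).mul tendsto_const_nhds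
    have hdiff : Tendsto (fun k => Complex.exp (-s (φ₁ (φ₂ k)) z) * c z - Hn (φ₁ (φ₂ k)) z)
        atTop (𝓝 0) :=
      squeeze_zero_norm (fun k => happ (φ₁ (φ₂ k)) z hz') herr
    have h := hez.sub hH
    have h0 := tendsto_nhds_unique h hdiff
    exact sub_eq_zero.1 h0
  refine ⟨S, g, Hlim, hg, hHlim, fun z hz => ?_, fun z hz => ?_⟩
  · -- the bound passes to the limit
    have hsz : Tendsto (fun k => s (φ₁ (φ₂ k)) z) atTop (𝓝 (g z)) := hgloc.tendsto_at hz
    exact le_of_tendsto hsz.norm (Eventually.of_forall fun k =>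
      hsS _ z (by linarith [mem_ball_zero_iff.1 hz]))
  · rw [← hident z hz, ← mul_assoc, ← Complex.exp_add, add_neg_cancel, Complex.exp_zero, one_mul]

/-! ### The leading term at a zero -/

/-- **Similarity principle for `C¹` functions: the leading term at a zero** (Wendl 2020,
Cor B.21). Let `c : ℂ → ℂ` be `C¹` with `‖∂̄ c‖ ≤ M ‖c‖` on `‖z‖ ≤ ρ`, `c 0 = 0`, and suppose `c`
does not vanish identically on the open disc. Then there are `m ≥ 1` and `C ≠ 0` with
`c z / z^m → C` as `z → 0` (`z ≠ 0`), i.e. `c(z) = C z^m + o(|z|^m)`.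
[cite: Wendl2020, App. B Cor B.21 (similarity principle)] -/
theorem similarity_leadingTerm_C1 (c : ℂ → ℂ) (M ρ : ℝ) (hc : ContDiff ℝ 1 c)
    (hbound : ∀ η : ℂ, ‖η‖ ≤ ρ → ‖dbarAlong 1 c η‖ ≤ M * ‖c η‖) (h0 : c 0 = 0)
    (hne : ∃ z : ℂ, ‖z‖ < ρ ∧ c z ≠ 0) :
    ∃ (m : ℕ) (C : ℂ), 1 ≤ m ∧ C ≠ 0 ∧
      Tendsto (fun z => c z / z ^ m) (𝓝[≠] 0) (𝓝 C) := by
  obtain ⟨z₁, hz₁, h1⟩ := hne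
  obtain ⟨ρ', hz₁', hρ'⟩ : ∃ ρ' : ℝ, ‖z₁‖ < ρ' ∧ ρ' < ρ := ⟨(‖z₁‖ + ρ) / 2, by linarith, by linarith⟩
  have hρ'0 : 0 < ρ' := (norm_nonneg _).trans_lt hz₁'
  obtain ⟨S, s, H, hs, hH, -, hfac⟩ := similarity_factorisation_C1 c M ρ ρ' hρ'0 hρ' hc hbound
  have h0mem : (0 : ℂ) ∈ ball (0 : ℂ) ρ' := mem_ball_self hρ'0
  -- `H 0 = 0`, `H z₁ ≠ 0`
  have hH0 : H 0 = 0 := by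
    have h := hfac 0 h0mem
    rw [h0] at h
    exact (mul_eq_zero.1 h.symm).resolve_left (Complex.exp_ne_zero _)
  have hH1 : H z₁ ≠ 0 := fun h => by
    have h' := hfac z₁ (mem_ball_zero_iff.2 hz₁')
    rw [h, mul_zero] at h'
    exact h1 h'
  -- `H` is not identically zero near `0`
  have hA : AnalyticOnNhd ℂ H (ball 0 ρ') := hH.analyticOnNhd isOpen_ball
  have hA0 : AnalyticAt ℂ H 0 := hA 0 h0mem
  have hnz : ¬ (∀ᶠ z in 𝓝 (0 : ℂ), H z = 0) := fun hev =>
    hH1 (hA.eqOn_zero_of_preconnected_of_eventuallyEq_zero (convex_ball 0 ρ').isPreconnected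
      h0mem hev (mem_ball_zero_iff.2 hz₁'))
  obtain ⟨m, G, hG, hG0, hHG⟩ := hA0.exists_eventuallyEq_pow_smul_nonzero_iff.mpr hnz
  -- `m ≥ 1` since `H 0 = 0`
  have hm : 1 ≤ m := by
    rcases Nat.eq_zero_or_pos m with hm0 | hm0
    · exfalso
      have h := hHG.self_of_nhds
      rw [hm0, pow_zero, one_smul, hH0] at h
      exact hG0 h.symm
    · exact hm0
  refine ⟨m, Complex.exp (s 0) * G 0, hm, mul_ne_zero (Complex.exp_ne_zero _) hG0, ?_⟩
  -- `c z / z^m = e^{s z} G z` near `0`, `z ≠ 0`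
  have hsc : ContinuousAt s 0 := hs.continuousAt (isOpen_ball.mem_nhds h0mem)
  have hlim : Tendsto (fun z => Complex.exp (s z) * G z) (𝓝[≠] (0 : ℂ))
      (𝓝 (Complex.exp (s 0) * G 0)) :=
    (((Complex.continuous_exp.continuousAt.comp hsc).mul hG.continuousAt).tendsto).mono_left
      nhdsWithin_le_nhds
  refine hlim.congr' ?_
  have hball : ∀ᶠ z in 𝓝[≠] (0 : ℂ), z ∈ ball (0 : ℂ) ρ' :=
    mem_nhdsWithin_of_mem_nhds (isOpen_ball.mem_nhds h0mem)
  have hHG' : ∀ᶠ z in 𝓝[≠] (0 : ℂ), H z = (z - 0) ^ m • G z := hHG.filter_mono nhdsWithin_le_nhds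
  filter_upwards [hball, hHG', self_mem_nhdsWithin] with z hz hz2 hz0
  rw [hfac z hz, hz2, sub_zero, smul_eq_mul, mul_comm (z ^ m) (G z), ← mul_assoc,
    mul_div_cancel_right₀ _ (pow_ne_zero m (show z ≠ 0 from hz0))]

/-! ### Local form at a puncture -/

/-- **`C¹` extension across a point.** If `f` is `C¹` on the punctured disc `0 < ‖z‖ < R`,
`f 0 = 0`, `‖f z‖ ≤ C ‖z‖^{k+1}` on the disc and `‖Df z‖ ≤ C ‖z‖^k` on the punctured disc, with
`k ≥ 1`, then `f` is `C¹` on the whole disc and `Df(0) = 0`. [folklore] -/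
theorem contDiffOn_one_of_punctured_bounds {f : ℂ → ℂ} {R C : ℝ} {k : ℕ} (hR : 0 < R)
    (hk : 1 ≤ k) (hf : ContDiffOn ℝ 1 f (ball 0 R \ {0})) (hf0 : f 0 = 0)
    (hb0 : ∀ z ∈ ball (0 : ℂ) R, ‖f z‖ ≤ C * ‖z‖ ^ (k + 1))
    (hb1 : ∀ z ∈ ball (0 : ℂ) R \ {0}, ‖fderiv ℝ f z‖ ≤ C * ‖z‖ ^ k) :
    ContDiffOn ℝ 1 f (ball 0 R) ∧ fderiv ℝ f 0 = 0 := by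
  have hopen : IsOpen (ball (0 : ℂ) R \ {0}) := isOpen_ball.sdiff isClosed_singleton
  have hfd : DifferentiableOn ℝ f (ball 0 R \ {0}) := hf.differentiableOn one_ne_zero
  have hfc : ContinuousOn (fderiv ℝ f) (ball 0 R \ {0}) :=
    hf.continuousOn_fderiv_of_isOpen hopen le_rfl
  have hC' : 0 < |C| + 1 := by positivity
  have hCε : ∀ ε : ℝ, 0 < ε → |C| * (ε / (|C| + 1)) < ε := fun ε hε => by
    rw [mul_div_assoc', div_lt_iff₀ hC']
    nlinarith [abs_nonneg C]
  -- `|z|^j ≤ |z|` on the unit disc for `j ≥ 1`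
  have hpow : ∀ (z : ℂ) (j : ℕ), 1 ≤ j → ‖z‖ ≤ 1 → ‖z‖ ^ j ≤ ‖z‖ := fun z j hj hz1 => by
    calc ‖z‖ ^ j ≤ ‖z‖ ^ 1 := pow_le_pow_of_le_one (norm_nonneg _) hz1 hj
      _ = ‖z‖ := pow_one _
  -- the derivative at `0` vanishes
  have hd0 : HasFDerivAt f (0 : ℂ →L[ℝ] ℂ) 0 := by
    rw [hasFDerivAt_iff_isLittleO_nhds_zero, Asymptotics.isLittleO_iff]
    intro ε hε
    have hr : 0 < min 1 (ε / (|C| + 1)) := lt_min one_pos (by positivity)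
    filter_upwards [ball_mem_nhds (0 : ℂ) hR, ball_mem_nhds (0 : ℂ) hr] with z hzR hzr
    rw [mem_ball_zero_iff] at hzR hzr
    have hz1 : ‖z‖ < 1 := lt_of_lt_of_le hzr (min_le_left _ _)
    have hzε : ‖z‖ < ε / (|C| + 1) := lt_of_lt_of_le hzr (min_le_right _ _)
    simp only [zero_add, hf0, sub_zero, _root_.zero_apply]
    calc ‖f z‖ ≤ C * ‖z‖ ^ (k + 1) := hb0 z (mem_ball_zero_iff.2 hzR)
      _ ≤ |C| * ‖z‖ ^ (k + 1) := by gcongr; exact le_abs_self C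
      _ = |C| * ‖z‖ ^ k * ‖z‖ := by ring
      _ ≤ |C| * ‖z‖ * ‖z‖ := by gcongr; exact hpow z k hk hz1.le
      _ ≤ |C| * (ε / (|C| + 1)) * ‖z‖ := by gcongr
      _ ≤ ε * ‖z‖ := mul_le_mul_of_nonneg_right (hCε ε hε).le (norm_nonneg _)
  have hfd0 : fderiv ℝ f 0 = 0 := hd0.fderiv
  have hdiff : DifferentiableOn ℝ f (ball 0 R) := by
    intro z hz
    by_cases hz0 : z = 0
    · subst hz0
      exact hd0.differentiableAt.differentiableWithinAt
    · exact ((hfd z ⟨hz, hz0⟩).differentiableAt (hopen.mem_nhds ⟨hz, hz0⟩)).differentiableWithinAt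
  have hcont : ContinuousOn (fderiv ℝ f) (ball 0 R) := by
    intro z hz
    by_cases hz0 : z = 0
    · subst hz0
      rw [ContinuousWithinAt, hfd0, Metric.tendsto_nhds]
      intro ε hε
      have hr : 0 < min 1 (ε / (|C| + 1)) := lt_min one_pos (by positivity)
      have hmem : ball (0 : ℂ) R ∩ ball 0 (min 1 (ε / (|C| + 1))) ∈ 𝓝[ball 0 R] (0 : ℂ) :=
        inter_mem_nhdsWithin _ (ball_mem_nhds 0 hr)
      filter_upwards [hmem] with z hz
      obtain ⟨hzR, hzr⟩ := hz
      rw [mem_ball_zero_iff] at hzr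
      rw [dist_zero_right]
      by_cases hz0' : z = 0
      · rw [hz0', hfd0, norm_zero]; exact hε
      · have hz1 : ‖z‖ < 1 := lt_of_lt_of_le hzr (min_le_left _ _)
        have hzε : ‖z‖ < ε / (|C| + 1) := lt_of_lt_of_le hzr (min_le_right _ _)
        calc ‖fderiv ℝ f z‖ ≤ C * ‖z‖ ^ k := hb1 z ⟨hzR, hz0'⟩
          _ ≤ |C| * ‖z‖ ^ k := by gcongr; exact le_abs_self C
          _ ≤ |C| * ‖z‖ := by gcongr; exact hpow z k hk hz1.le
          _ ≤ |C| * (ε / (|C| + 1)) := by gcongr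
          _ < ε := hCε ε hε
    · exact (hfc.continuousAt (hopen.mem_nhds ⟨hz, hz0⟩)).continuousWithinAt
  refine ⟨?_, hfd0⟩
  rw [show (1 : WithTop ℕ∞) = 0 + 1 from (zero_add 1).symm,
    contDiffOn_succ_iff_fderiv_of_isOpen isOpen_ball]
  exact ⟨hdiff, by simp, contDiffOn_zero.2 hcont⟩

/-- If `f z / z^m → A ≠ 0` as `z → 0` and `‖f z‖ ≤ C ‖z‖^{k+1}` near `0`, then `k + 1 ≤ m`.
[folklore] -/
theorem le_of_tendsto_div_pow_of_norm_le_pow {f : ℂ → ℂ} {A : ℂ} {m k : ℕ} {R C : ℝ}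
    (hR : 0 < R) (hA : A ≠ 0) (hb0 : ∀ z ∈ ball (0 : ℂ) R, ‖f z‖ ≤ C * ‖z‖ ^ (k + 1))
    (hlim : Tendsto (fun z => f z / z ^ m) (𝓝[≠] 0) (𝓝 A)) : k + 1 ≤ m := by
  by_contra hlt
  push Not at hlt
  have hzero : Tendsto (fun z => f z / z ^ m) (𝓝[≠] (0 : ℂ)) (𝓝 0) := by
    have hb : ∀ᶠ z in 𝓝[≠] (0 : ℂ), ‖f z / z ^ m‖ ≤ |C| * ‖z‖ ^ (k + 1 - m) := by
      have hball : ∀ᶠ z in 𝓝[≠] (0 : ℂ), z ∈ ball (0 : ℂ) R :=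
        mem_nhdsWithin_of_mem_nhds (ball_mem_nhds 0 hR)
      filter_upwards [hball, self_mem_nhdsWithin] with z hz hz0
      have hzpos : 0 < ‖z‖ := norm_pos_iff.2 hz0
      rw [norm_div, norm_pow, div_le_iff₀ (pow_pos hzpos m)]
      calc ‖f z‖ ≤ C * ‖z‖ ^ (k + 1) := hb0 z hz
        _ ≤ |C| * ‖z‖ ^ (k + 1) := by gcongr; exact le_abs_self C
        _ = |C| * ‖z‖ ^ (k + 1 - m) * ‖z‖ ^ m := by
            rw [mul_assoc, ← pow_add, Nat.sub_add_cancel (by omega)]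
    have hlim0 : Tendsto (fun z : ℂ => |C| * ‖z‖ ^ (k + 1 - m)) (𝓝[≠] (0 : ℂ)) (𝓝 0) := by
      have h1 : Tendsto (fun z : ℂ => |C| * ‖z‖ ^ (k + 1 - m)) (𝓝 (0 : ℂ))
          (𝓝 (|C| * ‖(0 : ℂ)‖ ^ (k + 1 - m))) :=
        (continuous_const.mul (continuous_norm.pow _)).tendsto 0
      rw [norm_zero, zero_pow (by omega), mul_zero] at h1
      exact h1.mono_left nhdsWithin_le_nhds
    exact squeeze_zero_norm' hb hlim0
  exact hA (tendsto_nhds_unique hlim hzero)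

/-- **Similarity principle at a puncture: the dichotomy with leading term** (Wendl 2020,
Thm B.20 / Cor B.21, for functions which are `C¹` only after extension by zero). Let `f : ℂ → ℂ` be
`C¹` on the punctured disc `0 < ‖z‖ < R` with `f 0 = 0`, `‖f z‖ ≤ C ‖z‖^{k+1}`,
`‖Df z‖ ≤ C ‖z‖^k` (`k ≥ 1`) and `‖∂̄ f‖ ≤ M ‖f‖` there. Then EITHER `f` vanishes identically near
`0`, OR there are `m ≥ k + 1` and `A ≠ 0` with `f z / z^m → A` as `z → 0`; in the latter case
`f ≠ 0` on a punctured neighbourhood of `0`. This is the analytic input of the representation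
formula for branch differences of `J`-holomorphic curves at critical points (Thm B.23, (B.12)).
[cite: Wendl2020, App. B Thm B.20, Cor B.21 and Thm B.23] -/
theorem similarity_dichotomy_punctured (f : ℂ → ℂ) {R C M : ℝ} {k : ℕ} (hR : 0 < R)
    (hk : 1 ≤ k) (hf : ContDiffOn ℝ 1 f (ball 0 R \ {0})) (hf0 : f 0 = 0)
    (hb0 : ∀ z ∈ ball (0 : ℂ) R, ‖f z‖ ≤ C * ‖z‖ ^ (k + 1))
    (hb1 : ∀ z ∈ ball (0 : ℂ) R \ {0}, ‖fderiv ℝ f z‖ ≤ C * ‖z‖ ^ k)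
    (hdbar : ∀ z ∈ ball (0 : ℂ) R \ {0}, ‖dbarAlong 1 f z‖ ≤ M * ‖f z‖) :
    (∀ᶠ z in 𝓝 (0 : ℂ), f z = 0) ∨
      ∃ (m : ℕ) (A : ℂ), k + 1 ≤ m ∧ A ≠ 0 ∧
        Tendsto (fun z => f z / z ^ m) (𝓝[≠] 0) (𝓝 A) ∧ ∀ᶠ z in 𝓝[≠] (0 : ℂ), f z ≠ 0 := by
  obtain ⟨hf1, hfd0⟩ := contDiffOn_one_of_punctured_bounds hR hk hf hf0 hb0 hb1
  -- a compactly supported `C¹` modification `c = χ f`, equal to `f` on `‖z‖ ≤ R/2`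
  obtain ⟨χ, hχ, -, hχ1, hχ0, -⟩ :=
    Similarity.exists_cutoff (ρm := R / 2) (ρ := 3 * R / 4) (half_pos hR) (by linarith)
  set c : ℂ → ℂ := fun z => χ z * f z with hc_def
  have hc : ContDiff ℝ 1 c := by
    rw [contDiff_iff_contDiffAt]
    intro s
    by_cases hs : ‖s‖ < R
    · exact (hχ.of_le (by exact_mod_cast le_top)).contDiffAt.mul
        (hf1.contDiffAt (isOpen_ball.mem_nhds (mem_ball_zero_iff.2 hs)))
    · have h0 : c =ᶠ[𝓝 s] fun _ => 0 := by
        have hopen : IsOpen {z : ℂ | 3 * R / 4 < ‖z‖} :=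
          isOpen_lt continuous_const continuous_norm
        have hs' : s ∈ {z : ℂ | 3 * R / 4 < ‖z‖} := by
          show 3 * R / 4 < ‖s‖
          linarith [not_lt.1 hs]
        filter_upwards [hopen.mem_nhds hs'] with z hz
        have hχz : χ z = 0 := by
          by_contra hne
          have h := hχ0 z hne
          exact absurd h (not_lt.2 (le_of_lt hz))
        simp [hc_def, hχz]
      exact contDiffAt_const.congr_of_eventuallyEq h0
  have hceq : ∀ z : ℂ, ‖z‖ ≤ R / 2 → c z = f z := fun z hz => by simp [hc_def, hχ1 z hz]
  have hc0 : c 0 = 0 := by rw [hceq 0 (by rw [norm_zero]; positivity), hf0]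
  have hcev : ∀ z : ℂ, ‖z‖ < R / 2 → c =ᶠ[𝓝 z] f := fun z hz => by
    filter_upwards [isOpen_ball.mem_nhds (mem_ball_zero_iff.2 hz)] with y hy
    exact hceq y (mem_ball_zero_iff.1 hy).le
  -- the `∂̄`-inequality for `c` on `‖z‖ ≤ R/4`
  set ρ : ℝ := R / 4 with hρ_def
  have hρ : 0 < ρ := by positivity
  have hbound : ∀ η : ℂ, ‖η‖ ≤ ρ → ‖dbarAlong 1 c η‖ ≤ M * ‖c η‖ := by
    intro η hη
    have hηR : ‖η‖ < R / 2 := by rw [hρ_def] at hη; linarith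
    rw [dbarAlong_congr_of_eventuallyEq (hcev η hηR) 1, hceq η hηR.le]
    by_cases hη0 : η = 0
    · subst hη0
      rw [dbarAlong_one, hfd0, hf0]
      simp
    · exact hdbar η ⟨mem_ball_zero_iff.2 (by linarith), hη0⟩
  -- `c = f` on a punctured neighbourhood of `0`
  have hcf : ∀ᶠ z in 𝓝[≠] (0 : ℂ), c z = f z :=
    mem_nhdsWithin_of_mem_nhds (hcev 0 (by rw [norm_zero]; positivity))
  by_cases hne : ∃ z : ℂ, ‖z‖ < ρ ∧ c z ≠ 0
  · right
    obtain ⟨m, A, -, hA, hlim⟩ := similarity_leadingTerm_C1 c M ρ hc hbound hc0 hne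
    have hlimf : Tendsto (fun z => f z / z ^ m) (𝓝[≠] 0) (𝓝 A) :=
      hlim.congr' (hcf.mono fun z hz => by rw [hz])
    refine ⟨m, A, le_of_tendsto_div_pow_of_norm_le_pow hR hA hb0 hlimf, hA, hlimf, ?_⟩
    exact (hlimf.eventually_ne hA).mono fun z hz hfz => hz (by rw [hfz, zero_div])
  · left
    push Not at hne
    filter_upwards [ball_mem_nhds (0 : ℂ) hρ] with z hz
    have hz' : ‖z‖ < ρ := mem_ball_zero_iff.1 hz
    rw [← hceq z (by rw [hρ_def] at hz'; linarith)]
    exact hne z hz'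

/-- **Similarity principle at a puncture, bounded-derivative form.** As
`similarity_dichotomy_punctured`, but requiring of the derivative only BOUNDEDNESS near the
puncture (and allowing `k = 0`): if `f` is `C¹` on `0 < ‖z‖ < R` with `f 0 = 0`,
`‖f z‖ ≤ C ‖z‖^{k+1}`, `‖Df z‖ ≤ B` and `‖∂̄ f z‖ ≤ M ‖f z‖` there, then either `f ≡ 0` near `0` or
`f z / z^m → A ≠ 0` for some `m ≥ k + 1`, with `f ≠ 0` on a punctured neighbourhood. (Apply the
previous theorem to `z f(z)`, whose derivative decays linearly and which satisfies the same
`∂̄`-inequality since `∂̄ z = 0`.) [cite: Wendl2020, App. B Cor B.21 and Thm B.23] -/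
theorem similarity_dichotomy_punctured_of_fderiv_bounded (f : ℂ → ℂ) {R C B M : ℝ} {k : ℕ}
    (hR : 0 < R) (hf : ContDiffOn ℝ 1 f (ball 0 R \ {0})) (hf0 : f 0 = 0)
    (hb0 : ∀ z ∈ ball (0 : ℂ) R, ‖f z‖ ≤ C * ‖z‖ ^ (k + 1))
    (hb1 : ∀ z ∈ ball (0 : ℂ) R \ {0}, ‖fderiv ℝ f z‖ ≤ B)
    (hdbar : ∀ z ∈ ball (0 : ℂ) R \ {0}, ‖dbarAlong 1 f z‖ ≤ M * ‖f z‖) :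
    (∀ᶠ z in 𝓝 (0 : ℂ), f z = 0) ∨
      ∃ (m : ℕ) (A : ℂ), k + 1 ≤ m ∧ A ≠ 0 ∧
        Tendsto (fun z => f z / z ^ m) (𝓝[≠] 0) (𝓝 A) ∧ ∀ᶠ z in 𝓝[≠] (0 : ℂ), f z ≠ 0 := by
  -- shrink to `R₁ = min R 1` and pass to `F z = z f z`
  set R₁ : ℝ := min R 1 with hR₁_def
  have hR₁ : 0 < R₁ := lt_min hR one_pos
  have hR₁R : R₁ ≤ R := min_le_left _ _
  have hR₁1 : R₁ ≤ 1 := min_le_right _ _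
  have hsub : ball (0 : ℂ) R₁ \ {0} ⊆ ball 0 R \ {0} := fun z hz =>
    ⟨ball_subset_ball hR₁R hz.1, hz.2⟩
  have hopen : IsOpen (ball (0 : ℂ) R \ {0}) := isOpen_ball.sdiff isClosed_singleton
  set F : ℂ → ℂ := fun z => z * f z with hF_def
  have hF : ContDiffOn ℝ 1 F (ball 0 R₁ \ {0}) := contDiffOn_id.mul (hf.mono hsub)
  have hF0 : F 0 = 0 := by simp [hF_def]
  -- the derivative of `F`
  have hDF : ∀ z ∈ ball (0 : ℂ) R \ {0},
      HasFDerivAt F (z • fderiv ℝ f z + f z • ContinuousLinearMap.id ℝ ℂ) z := by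
    intro z hz
    have hfz : HasFDerivAt f (fderiv ℝ f z) z :=
      ((hf.differentiableOn one_ne_zero z hz).differentiableAt (hopen.mem_nhds hz)).hasFDerivAt
    have h := (hasFDerivAt_id (𝕜 := ℝ) z).mul hfz
    simpa [hF_def, Pi.mul_def] using h
  set C' : ℝ := |C| + |B| with hC'_def
  have hb0' : ∀ z ∈ ball (0 : ℂ) R₁, ‖F z‖ ≤ C' * ‖z‖ ^ (1 + 1) := by
    intro z hz
    have hz1 : ‖z‖ ≤ 1 := (mem_ball_zero_iff.1 hz).le.trans hR₁1
    have hzR : z ∈ ball (0 : ℂ) R := ball_subset_ball hR₁R hz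
    calc ‖F z‖ = ‖z‖ * ‖f z‖ := norm_mul _ _
      _ ≤ ‖z‖ * (|C| * ‖z‖ ^ (k + 1)) := by
          gcongr
          exact (hb0 z hzR).trans (by gcongr; exact le_abs_self C)
      _ ≤ ‖z‖ * (|C| * ‖z‖ ^ 1) := by
          gcongr ‖z‖ * (|C| * ?_)
          exact pow_le_pow_of_le_one (norm_nonneg _) hz1 (by omega)
      _ = |C| * ‖z‖ ^ (1 + 1) := by ring
      _ ≤ C' * ‖z‖ ^ (1 + 1) := by gcongr; simp [hC'_def, abs_nonneg]
  have hb1' : ∀ z ∈ ball (0 : ℂ) R₁ \ {0}, ‖fderiv ℝ F z‖ ≤ C' * ‖z‖ ^ 1 := by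
    intro z hz
    have hz1 : ‖z‖ ≤ 1 := (mem_ball_zero_iff.1 hz.1).le.trans hR₁1
    have hzR : z ∈ ball (0 : ℂ) R \ {0} := hsub hz
    rw [(hDF z hzR).fderiv, pow_one]
    calc ‖z • fderiv ℝ f z + f z • ContinuousLinearMap.id ℝ ℂ‖
        ≤ ‖z • fderiv ℝ f z‖ + ‖f z • ContinuousLinearMap.id ℝ ℂ‖ := norm_add_le _ _
      _ ≤ ‖z‖ * ‖fderiv ℝ f z‖ + ‖f z‖ * 1 := by
          rw [norm_smul, norm_smul]
          gcongr
          exact ContinuousLinearMap.norm_id_le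
      _ ≤ ‖z‖ * |B| + |C| * ‖z‖ ^ (k + 1) * 1 := by
          gcongr
          · exact (hb1 z hzR).trans (le_abs_self B)
          · exact (hb0 z hzR.1).trans (by gcongr; exact le_abs_self C)
      _ ≤ ‖z‖ * |B| + |C| * ‖z‖ ^ 1 * 1 := by
          gcongr ‖z‖ * |B| + |C| * ?_ * 1
          exact pow_le_pow_of_le_one (norm_nonneg _) hz1 (by omega)
      _ = C' * ‖z‖ := by rw [hC'_def]; ring
  have hdbar' : ∀ z ∈ ball (0 : ℂ) R₁ \ {0}, ‖dbarAlong 1 F z‖ ≤ M * ‖F z‖ := by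
    intro z hz
    have hzR : z ∈ ball (0 : ℂ) R \ {0} := hsub hz
    have hD : dbarAlong 1 F z = z * dbarAlong 1 f z := by
      rw [dbarAlong_one, dbarAlong_one, (hDF z hzR).fderiv]
      simp only [_root_.add_apply, _root_.smul_apply, ContinuousLinearMap.id_apply, smul_eq_mul]
      linear_combination (2 : ℂ)⁻¹ * f z * I_mul_I
    rw [hD, norm_mul, show ‖F z‖ = ‖z‖ * ‖f z‖ from norm_mul _ _]
    calc ‖z‖ * ‖dbarAlong 1 f z‖ ≤ ‖z‖ * (M * ‖f z‖) := by gcongr; exact hdbar z hzR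
      _ = M * (‖z‖ * ‖f z‖) := by ring
  rcases similarity_dichotomy_punctured F hR₁ le_rfl hF hF0 hb0' hb1' hdbar' with h | ⟨m', A, hm', hA, hlim, hne⟩
  · left
    filter_upwards [h] with z hz
    rcases eq_or_ne z 0 with rfl | hz0
    · exact hf0
    · exact (mul_eq_zero.1 hz).resolve_left hz0
  · right
    obtain ⟨m, rfl⟩ : ∃ m, m' = m + 1 := ⟨m' - 1, by omega⟩
    have hlimf : Tendsto (fun z => f z / z ^ m) (𝓝[≠] 0) (𝓝 A) := by
      refine hlim.congr' ?_
      filter_upwards [self_mem_nhdsWithin] with z hz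
      simp only [hF_def]
      rw [pow_succ, mul_comm (z ^ m) z, mul_div_mul_left _ _ (show z ≠ 0 from hz)]
    refine ⟨m, A, le_of_tendsto_div_pow_of_norm_le_pow hR hA hb0 hlimf, hA, hlimf, ?_⟩
    exact hne.mono fun z hz hfz => hz (by simp [hF_def, hfz])

/-- **Similarity principle at a puncture, without normalising `f 0`.** As
`similarity_dichotomy_punctured_of_fderiv_bounded`, for an `f` about whose value at `0` nothing
is assumed (the size bound is required on the punctured disc only); the conclusion is stated on
punctured neighbourhoods. [cite: Wendl2020, App. B Cor B.21 and Thm B.23] -/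
theorem similarity_dichotomy_punctured' (f : ℂ → ℂ) {R C B M : ℝ} {k : ℕ}
    (hR : 0 < R) (hf : ContDiffOn ℝ 1 f (ball 0 R \ {0}))
    (hb0 : ∀ z ∈ ball (0 : ℂ) R \ {0}, ‖f z‖ ≤ C * ‖z‖ ^ (k + 1))
    (hb1 : ∀ z ∈ ball (0 : ℂ) R \ {0}, ‖fderiv ℝ f z‖ ≤ B)
    (hdbar : ∀ z ∈ ball (0 : ℂ) R \ {0}, ‖dbarAlong 1 f z‖ ≤ M * ‖f z‖) :
    (∀ᶠ z in 𝓝[≠] (0 : ℂ), f z = 0) ∨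
      ∃ (m : ℕ) (A : ℂ), k + 1 ≤ m ∧ A ≠ 0 ∧
        Tendsto (fun z => f z / z ^ m) (𝓝[≠] 0) (𝓝 A) ∧ ∀ᶠ z in 𝓝[≠] (0 : ℂ), f z ≠ 0 := by
  set g : ℂ → ℂ := Function.update f 0 0 with hg_def
  have hgf : ∀ z : ℂ, z ≠ 0 → g z = f z := fun z hz => by simp [hg_def, hz]
  have hgfev : ∀ z : ℂ, z ≠ 0 → g =ᶠ[𝓝 z] f := fun z hz => by
    filter_upwards [isOpen_compl_singleton.mem_nhds hz] with y hy
    exact hgf y hy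
  have hg0 : g 0 = 0 := by simp [hg_def]
  have hgc : ContDiffOn ℝ 1 g (ball 0 R \ {0}) :=
    hf.congr fun z hz => hgf z hz.2
  have hb0' : ∀ z ∈ ball (0 : ℂ) R, ‖g z‖ ≤ C * ‖z‖ ^ (k + 1) := by
    intro z hz
    rcases eq_or_ne z 0 with rfl | hz0
    · simp [hg0]
    · rw [hgf z hz0]; exact hb0 z ⟨hz, hz0⟩
  have hb1' : ∀ z ∈ ball (0 : ℂ) R \ {0}, ‖fderiv ℝ g z‖ ≤ B := fun z hz => by
    rw [(hgfev z hz.2).fderiv_eq]; exact hb1 z hz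
  have hdbar' : ∀ z ∈ ball (0 : ℂ) R \ {0}, ‖dbarAlong 1 g z‖ ≤ M * ‖g z‖ := fun z hz => by
    rw [dbarAlong_congr_of_eventuallyEq (hgfev z hz.2) 1, hgf z hz.2]; exact hdbar z hz
  rcases similarity_dichotomy_punctured_of_fderiv_bounded g hR hgc hg0 hb0' hb1' hdbar' with
    h | ⟨m, A, hm, hA, hlim, hne⟩
  · left
    filter_upwards [mem_nhdsWithin_of_mem_nhds h, self_mem_nhdsWithin] with z hz hz0
    rwa [hgf z hz0] at hz
  · right
    refine ⟨m, A, hm, hA, hlim.congr' ?_, ?_⟩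
    · filter_upwards [self_mem_nhdsWithin] with z hz0
      rw [hgf z hz0]
    · filter_upwards [hne, self_mem_nhdsWithin] with z hz hz0
      rwa [hgf z hz0] at hz

/-- From `f z / z^m → A` (`z → 0`, `z ≠ 0`) and `f 0 = 0`, `m ≥ 1`, to the Landau form
`f z - A z^m = o(|z|^m)` at `0`. [folklore] -/
theorem isLittleO_sub_mul_pow_of_tendsto_div_pow {f : ℂ → ℂ} {A : ℂ} {m : ℕ} (hm : 1 ≤ m)
    (hf0 : f 0 = 0) (h : Tendsto (fun z => f z / z ^ m) (𝓝[≠] 0) (𝓝 A)) :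
    (fun z => f z - A * z ^ m) =o[𝓝 (0 : ℂ)] fun z => ‖z‖ ^ m := by
  have h1 : (fun z => f z - A * z ^ m) =o[𝓝[≠] (0 : ℂ)] fun z => ‖z‖ ^ m := by
    have ht : Tendsto (fun z => f z / z ^ m - A) (𝓝[≠] (0 : ℂ)) (𝓝 0) := by
      have := h.sub_const A
      rwa [sub_self] at this
    have heq : ∀ᶠ z in 𝓝[≠] (0 : ℂ), f z - A * z ^ m = (f z / z ^ m - A) * z ^ m := by
      filter_upwards [self_mem_nhdsWithin] with z hz
      rw [sub_mul, div_mul_cancel₀ _ (pow_ne_zero m (show z ≠ 0 from hz))]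
    refine Asymptotics.isLittleO_iff.2 fun c hc => ?_
    have hev := (Metric.tendsto_nhds.1 ht) c hc
    filter_upwards [heq, hev] with z hz1 hz2
    rw [hz1, norm_mul, norm_pow, Real.norm_of_nonneg (pow_nonneg (norm_nonneg _) _)]
    rw [dist_zero_right] at hz2
    exact mul_le_mul_of_nonneg_right hz2.le (pow_nonneg (norm_nonneg _) _)
  have h2 := h1.insert (show f 0 - A * (0 : ℂ) ^ m = 0 by
    rw [hf0, zero_pow (by omega), mul_zero, sub_zero])
  have hins : insert (0 : ℂ) ({0}ᶜ : Set ℂ) = univ := by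
    ext z
    by_cases hz : z = 0 <;> simp [hz]
  rwa [hins, nhdsWithin_univ] at h2

/-- **Transfer of a leading term through a relative perturbation.** If `η z / z^m → A` and
`‖g z - η z‖ ≤ e z ‖η z‖` near `0` with `e → 0`, then `g z / z^m → A` as well (used to pass the
leading term of the normal push-off coordinate of a branch difference to the difference of the
graph branches themselves). [folklore] -/
theorem tendsto_div_pow_of_norm_sub_le {η g : ℂ → ℂ} {e : ℂ → ℝ} {A : ℂ} {m : ℕ}
    (hη : Tendsto (fun z => η z / z ^ m) (𝓝[≠] 0) (𝓝 A))
    (he : Tendsto e (𝓝[≠] 0) (𝓝 0))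
    (hge : ∀ᶠ z in 𝓝[≠] (0 : ℂ), ‖g z - η z‖ ≤ e z * ‖η z‖) :
    Tendsto (fun z => g z / z ^ m) (𝓝[≠] 0) (𝓝 A) := by
  have h1 : Tendsto (fun z => g z / z ^ m - η z / z ^ m) (𝓝[≠] (0 : ℂ)) (𝓝 0) := by
    have hb : Tendsto (fun z => e z * ‖η z / z ^ m‖) (𝓝[≠] (0 : ℂ)) (𝓝 (0 * ‖A‖)) :=
      he.mul hη.norm
    rw [zero_mul] at hb
    refine squeeze_zero_norm' ?_ hb
    filter_upwards [hge] with z hz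
    rw [← sub_div, norm_div, norm_div, ← mul_div_assoc]
    exact div_le_div_of_nonneg_right hz (norm_nonneg _)
  have h2 := h1.add hη
  rw [zero_add] at h2
  exact h2.congr' (Eventually.of_forall fun z => by simp only [sub_add_cancel])

/-- Unpacking the Landau form at the scale `½`: `‖f z - A z^m‖ ≤ ‖A‖ ‖z‖^m / 2` on a small closed
disc (the "aligned branch differences" hypothesis of the degree count for perturbed cusps).
[folklore] -/
theorem exists_norm_sub_mul_pow_le_half {f : ℂ → ℂ} {A : ℂ} {m : ℕ} (hA : A ≠ 0)
    (h : (fun z => f z - A * z ^ m) =o[𝓝 (0 : ℂ)] fun z => ‖z‖ ^ m) :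
    ∃ s₀ : ℝ, 0 < s₀ ∧ ∀ z : ℂ, ‖z‖ ≤ s₀ → ‖f z - A * z ^ m‖ ≤ ‖A‖ * ‖z‖ ^ m / 2 := by
  have hc : 0 < ‖A‖ / 2 := by positivity
  obtain ⟨ε, hε, hball⟩ := Metric.eventually_nhds_iff_ball.1 (h.def hc)
  refine ⟨ε / 2, half_pos hε, fun z hz => ?_⟩
  have h1 := hball z (mem_ball_zero_iff.2 (by linarith))
  rw [Real.norm_of_nonneg (pow_nonneg (norm_nonneg _) _)] at h1
  linarith

/-- **The index equals the order.** If `f z / z^m → A ≠ 0` as `z → 0` (`z ≠ 0`), then on every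
sufficiently small circle `‖z‖ = ε` the function `f` has no zero and the winding number of
`f ∘ circle` is `m` (Rouché against `A z^m`). [folklore] -/
theorem wind_circleLoop_eq_of_tendsto_div_pow {f : ℂ → ℂ} {A : ℂ} {m : ℕ} (hA : A ≠ 0)
    (hf : ContinuousOn f {0}ᶜ) (h : Tendsto (fun z => f z / z ^ m) (𝓝[≠] 0) (𝓝 A)) :
    ∀ᶠ ε in 𝓝[>] (0 : ℝ), (∀ z : ℂ, ‖z‖ = ε → f z ≠ 0) ∧
      wind (fun t => f (circleLoop 0 ε t)) = m := by
  -- `‖f z / z^m - A‖ < ‖A‖` on a punctured disc `0 < ‖z‖ < δ`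
  have hev : ∀ᶠ z in 𝓝[≠] (0 : ℂ), ‖f z / z ^ m - A‖ < ‖A‖ := by
    have := (Metric.tendsto_nhds.1 h) ‖A‖ (norm_pos_iff.2 hA)
    simpa [dist_eq_norm] using this
  obtain ⟨δ, hδ, hδball⟩ : ∃ δ > 0, ∀ z : ℂ, 0 < ‖z‖ → ‖z‖ < δ → ‖f z / z ^ m - A‖ < ‖A‖ := by
    rcases Metric.mem_nhdsWithin_iff.1 hev with ⟨δ, hδ, hsub⟩
    exact ⟨δ, hδ, fun z hz0 hzδ => hsub ⟨mem_ball_zero_iff.2 hzδ, norm_pos_iff.1 hz0⟩⟩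
  have hIoo : Ioo (0 : ℝ) δ ∈ 𝓝[>] (0 : ℝ) := Ioo_mem_nhdsGT hδ
  filter_upwards [hIoo] with ε hε
  obtain ⟨hε0, hεδ⟩ := hε
  -- on the circle: `‖f z - A z^m‖ < ‖A z^m‖`
  have hcirc : ∀ z : ℂ, ‖z‖ = ε → ‖f z - A * z ^ m‖ < ‖A * z ^ m‖ := by
    intro z hz
    have hz0 : z ≠ 0 := fun h0 => by rw [h0, norm_zero] at hz; exact hε0.ne hz
    have hzm : z ^ m ≠ 0 := pow_ne_zero m hz0
    have h1 := hδball z (norm_pos_iff.2 hz0) (hz ▸ hεδ)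
    have h2 : f z - A * z ^ m = (f z / z ^ m - A) * z ^ m := by
      rw [sub_mul, div_mul_cancel₀ _ hzm]
    rw [h2, norm_mul, norm_mul]
    exact mul_lt_mul_of_pos_right h1 (norm_pos_iff.2 hzm)
  have hne : ∀ z : ℂ, ‖z‖ = ε → f z ≠ 0 := by
    intro z hz h0
    have h1 := hcirc z hz
    rw [h0, zero_sub, norm_neg] at h1
    exact lt_irrefl _ h1
  refine ⟨hne, ?_⟩
  -- the comparison loop `A (circle)^m` winds `m` times
  have hnorm : ∀ t, ‖circleLoop 0 ε t‖ = ε := fun t => by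
    have h1 := norm_circleLoop_sub_center 0 ε t
    rwa [sub_zero, abs_of_pos hε0] at h1
  have hl : IsNonvanishingLoop (circleLoop 0 ε) :=
    isNonvanishingLoop_circleLoop (by simp [abs_of_pos hε0, hε0.ne])
  have hlA : IsNonvanishingLoop (fun _ : ℝ => A) :=
    ⟨continuousOn_const, fun _ _ => hA, rfl⟩
  have hlpow : IsNonvanishingLoop (fun t => circleLoop 0 ε t ^ m) :=
    ⟨((continuous_circleLoop 0 ε).pow m).continuousOn,
      fun t _ => pow_ne_zero m (fun h0 => by
        have h1 := hnorm t; rw [h0, norm_zero] at h1; exact hε0.ne h1),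
      by simp [circleLoop_zero_eq]⟩
  have hwg : wind (fun t => A * circleLoop 0 ε t ^ m) = m := by
    rw [wind_mul hlA hlpow, wind_const, zero_add]
    have h1 := wind_zpow hl (m : ℤ)
    simp only [zpow_natCast] at h1
    rw [h1, wind_circleLoop_zero hε0, mul_one]
  rw [← hwg]
  refine wind_eq_of_norm_sub_lt ?_ (by simp [circleLoop_zero_eq]) (hlA.mul hlpow) ?_
  · refine hf.comp (continuous_circleLoop 0 ε).continuousOn fun t _ => ?_
    show circleLoop 0 ε t ∈ ({0}ᶜ : Set ℂ)
    intro h0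
    have h1 := hnorm t
    rw [show circleLoop 0 ε t = 0 from h0, norm_zero] at h1
    exact hε0.ne h1
  · intro t _
    exact hcirc _ (hnorm t)

/-- **Similarity principle at a puncture, Landau form of the leading term.** Under the hypotheses
of `similarity_dichotomy_punctured_of_fderiv_bounded`: either `f ≡ 0` near `0`, or
`f(z) = A z^m + o(|z|^m)` with `m ≥ k + 1`, `A ≠ 0`, and `f ≠ 0` on a punctured neighbourhood of `0`
(the form (B.12) of Wendl 2020, Thm B.23). [cite: Wendl2020, App. B Cor B.21 and Thm B.23] -/
theorem similarity_dichotomy_punctured_landau (f : ℂ → ℂ) {R C B M : ℝ} {k : ℕ} (hR : 0 < R)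
    (hf : ContDiffOn ℝ 1 f (ball 0 R \ {0})) (hf0 : f 0 = 0)
    (hb0 : ∀ z ∈ ball (0 : ℂ) R, ‖f z‖ ≤ C * ‖z‖ ^ (k + 1))
    (hb1 : ∀ z ∈ ball (0 : ℂ) R \ {0}, ‖fderiv ℝ f z‖ ≤ B)
    (hdbar : ∀ z ∈ ball (0 : ℂ) R \ {0}, ‖dbarAlong 1 f z‖ ≤ M * ‖f z‖) :
    (∀ᶠ z in 𝓝 (0 : ℂ), f z = 0) ∨
      ∃ (m : ℕ) (A : ℂ), k + 1 ≤ m ∧ A ≠ 0 ∧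
        (fun z => f z - A * z ^ m) =o[𝓝 (0 : ℂ)] (fun z => ‖z‖ ^ m) ∧
          ∀ᶠ z in 𝓝[≠] (0 : ℂ), f z ≠ 0 := by
  rcases similarity_dichotomy_punctured_of_fderiv_bounded f hR hf hf0 hb0 hb1 hdbar with
    h | ⟨m, A, hm, hA, hlim, hne⟩
  · exact Or.inl h
  · exact Or.inr ⟨m, A, hm, hA, isLittleO_sub_mul_pow_of_tendsto_div_pow (by omega) hf0 hlim, hne⟩

end Literature.Analysis.Complex

end
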